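import Summits.QuantumFields.YangMills.Theorems.BalabanUVNodesN07SplitClauseHeadKnitMeetNormalised
import Summits.QuantumFields.YangMills.Theorems.BalabanUVNodesK0HalvingStepOfCoreGuardedChain
import HarnessLib

/-!
# N07 [B11] (= [15] = [Balaban1985Variational]) Sect. F, S6 HEAD — THE MEET KNIT UNDER PRINT's NORMALISED LANDAU GAUGE, **PART 2: THE GUARDED [15] PROP. 8 STEP TOKEN**
# (the sibling `…HeadKnitMeetNormalised` §1 composed with k0-s1-w3's guarded chain closer; split off for the line budget)

Cell `pub-ymgap`, seat `pub-ymgap-dag-n07-e` g23 (FAN-OUT §N07 row s3; LANE OWNER of the K0 road), MODULE 59 part 2, INTENT-59 (cell bus 2026-08-28T17:16Z).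
`--kind proof --supports stmt-QuantumFields-20541 --as helper` (K0⁷; dag-lead KEY MAP v2); count-neutral; def-free.
[15] = [Balaban1985Variational]; [6] = [Balaban1985RegularSpaces]; [I] = [Balaban1987RG1].

WHAT IS PROVED (sorry-free; no definition; axioms standard).  ★★★ `prop8RegSepTopStepG_of_normalisedGauge_of_chartMeet F N`: `Prop8RegSepTopStepG F N suppDom Adm B₃ a₀ a₁` for EVERY
guard `Adm` implying the V20-G conjuncts and the run's grid numerics and EVERY normalisation predicate `Nrm`, modulo the sibling's displayed HS3NORM (print p. 301: [6] Thm. 2's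
NORMALISED local Landau gauge «ū_j = 1 on Λ′_j» with (152)–(153) at every meeting clean datum, κ a free letter), HCHART-MEET-NORM (print's (154)–(159), shear-free),
HLETTERS-NORM ∕ HBUDGET-NORM (no `σ`, no `t_D`) and the κ-generic smallness letters `2L² ≤ B₃`, `4C ≤ B₃`, `16θ ≤ 1`, `(16Q + 1024κ²)a₀ ≤ 1`, `32κa₀ ≤ 1` — by
`prop8RegSepTopStepG_of_datumGaugeSplitCoreG` (k0-s1-w3, `…K0HalvingStepOfCoreGuardedChain`).  This is the V20-G stub-1 text's antecedent shape under exit (x4): the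
budget it displays is print's (δ-linear near rows, `e^{−δ_H ρ}`-damped far rows, (165) letters), not road R0′'s ε-linear shear rows (dag-n07-w4 LOCATED-BUDGET-SHEAR-THETA).
HONEST SCOPE.  Count-neutral by-name composition; every hypothesis DISPLAYED, none discharged; joint satisfiability at the record NOT claimed; `Nrm` abstract; NO stub registered
or closed; nothing of [15]∕[6] ANALYSIS asserted; K0⁷ ∕ K1⁹ NOT closed; N07 ∕ N05 NOT discharged; counts unmoved (typed 28∕28 · discharged 5∕27); one finite 𝕋⁴ programme at
fixed ε — the route closes the conditional finite-𝕋⁴ rung `BalabanLadder.UV` ONLY; the YM mass gap (Clay) is NOT proved by any of this; nothing continuum ∕ ℝ⁴ ∕ OS.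
No `sorry`, no `def`, no `instance`, no `notation`.

References: [15] (150)–(153) p. 301, (162)–(168) pp. 303–304, Prop. 8 p. 304; [6] Thm. 2 p. 83, (1.29) p. 80, (1.3)–(1.9) p. 77; [I] (0.1) p. 251.
-/

set_option autoImplicit false

noncomputable section
open scoped BigOperators Matrix.Norms.L2Operator

namespace Summit.QuantumFields.YangMills.BalabanUVNodes.N07SplitClauseHeadKnitMeetNormalisedStep

open Literature.MathematicalPhysics.QuantumFieldTheory.Balaban1983to89
open Literature.MathematicalPhysics.QuantumFieldTheory.Balaban1983to89.Node00
open Literature.MathematicalPhysics.QuantumFieldTheory.Balaban1983to89.B15DeterminingSets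
open Literature.MathematicalPhysics.QuantumFieldTheory.Balaban1983to89.B12RegularSpaces111 (gaugeU expI grad)
open B15Eq112TorusCover (cover)
open B14DomainGeom (Pt Within)
open B14.Eq213MaximalDomains (side cubeExt)
open B5Eq117TorusCarriers (Mk)
open B5Eq118OneStroke (iterBlockOf)
open B5Prop12FieldsLattice (distSite)
open B8Eq131Cubes (sqLo sqHi box cube)
open B8LeafModelZd (ZdIdx)
open B11Eq115Space (levOf)
open B6SectADomainsV1 (Domains)
open B6SectAOperatorsV1 (BondIdx RE dsE QpE)
open Literature.MathematicalPhysics.QuantumFieldTheory.BalabanImbrieJaffe1984to88.BIJ85AxialPropagator411 (BondSpace)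
open T4Continuum (T4Family)
open T4AxialGaugeSmallField (castSite)
open B16Sect1Backgrounds (toMS)
open GaugeField (gaugeAct)
open MatrixLog (mlog)
open Summit.QuantumFields.YangMills.Theorems.K0FlatCubeOpsTextP (flatH)
open Summit.QuantumFields.YangMills.BalabanUVNodes.N07HalvingStepTopOfLocalLetters (Letters10On)
open Summit.QuantumFields.YangMills.BalabanUVNodes.N07LocalLettersSplitCore (LocalGaugeSplitOn)
open Summit.QuantumFields.YangMills.BalabanUVNodes.N07LocalLettersCoreGuarded (DatumGaugeSplitTopStepCoreG)
open Summit.QuantumFields.YangMills.BalabanUVNodes.N07SplitClauseHeadKnitMeetNormalised (datumGaugeSplitTopStepCoreG_of_normalisedGauge_of_chartMeet)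
open Summit.QuantumFields.YangMills.Theorems.K0HalvingStepOfCoreGuardedChain (prop8RegSepTopStepG_of_datumGaugeSplitCoreG)

open scoped Classical in
/-- ★★★ **THE GUARDED [15] PROP. 8 STEP TOKEN FROM THE NORMALISED MEET KNIT** — §1 ∘ k0-s1-w3's `prop8RegSepTopStepG_of_datumGaugeSplitCoreG` (`2L² ≤ B₃`, `4C ≤ B₃`, `16θ ≤ 1`,
`(16Q + 1024κ²)a₀ ≤ 1`, `32κa₀ ≤ 1`, κ a FREE letter): `Prop8RegSepTopStepG F N suppDom Adm B₃ a₀ a₁` for EVERY guard `Adm` implying the V20-G conjuncts and the run's grid numerics,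
modulo HS3NORM (print's normalised [6] Thm. 2 at every meeting clean datum), HCHART-MEET-NORM (print's (154)–(159)), HLETTERS-NORM ∕ HBUDGET-NORM and the smallness letters (all
displayed); no stub registered or closed here.
[cite: Balaban1985Variational, Prop. 8 p.304, (150)–(153) p.301, (162)–(168) pp.303–304; Balaban1985RegularSpaces, Thm. 2 p.83, (1.29) p.80, (1.3)–(1.9) p.77; Balaban1987RG1, (0.1) p.251] -/
theorem prop8RegSepTopStepG_of_normalisedGauge_of_chartMeet (F : T4Family) (N : ℕ) [NeZero N] :
    ∃ (Mh₀ R₀ : ℕ) (CH δH BH : ℝ), 0 ≤ CH ∧ 0 < δH ∧ 0 < BH ∧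
    ∀ {ρ : ℕ}
      -- structural letters: grid cube `Mc`, block height `a′` (`M_h = L^{a′} ≥ M_h⁰`), `R ≥ R₀`, the collar `ρ` with `L·M_h ∣ ρ`, `R·L·M_h ≤ ρ`, `L ≤ ρ`
      {Mc Mh R a' : ℕ} (_ : 1 ≤ Mc) (_ : Mc ≤ ρ) (_ : Mh = F.L ^ a') (_ : Mh₀ ≤ Mh) (_ : R₀ ≤ R) (_ : F.L * Mh ∣ ρ) (_ : R * (F.L * Mh) ≤ ρ) (hLρ : F.L ≤ ρ)
      -- the two constants of the plan's V20-G guard `c ≤ ν.M₁ ∧ k + c₀ ≤ F.m + K` and their side conditions (as in FILE D)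
      {c c₀ : ℕ} (_ : (11 * 4 + 4 * ρ + Mc + 3) * F.L ≤ c) (_ : Mc + 11 * 4 + 6 * ρ ≤ 2 * F.L ^ c₀) (_ : F.m ≤ c₀) (_ : a' + 3 ≤ c₀)
      -- ★ THE GUARD: any step guard implying the V20-G conjuncts AND the run's grid numerics the meet's (2.1) needs (`hgran`, `hdiv`)
      (Adm : StepGuard F) (_ : ∀ (ν : Stage7Numerics) (M : ℕ) (g : ℕ → ℝ) (K k : ℕ) (s : SeqOfRecord F ν M g K k), Adm ν M g K k s → c ≤ ν.M₁ ∧ k + c₀ ≤ F.m + K)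
      (_ : ∀ (ν : Stage7Numerics) (M : ℕ) (g : ℕ → ℝ) (K k : ℕ) (s : SeqOfRecord F ν M g K k), Adm ν M g K k s → ∀ j : ℕ, 1 ≤ j → j ≤ k →
        F.L * Mh ∣ M * RkOfRecord (F.P K).L ν.r (g j) ∧ dCubeSide (F.P K).L M (RkOfRecord (F.P K).L ν.r (g j)) j ∣ (F.P K).sitesPerDir 0)
      -- the token's letters, `0 < B₃`, the FREE (152)-letter `κ ≥ 0`, the (163)-type letter `θ_H` of the `H` doors
      {B₃ C θ Q κ a₀ a₁ θH : ℝ} (_ : 0 < B₃) (_ : 0 ≤ C) (_ : 0 ≤ θ) (_ : 0 ≤ Q) (_ : 0 ≤ κ) (_ : 8 * CH * BH * Real.exp (-(δH * (ρ : ℝ))) ≤ θH)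
      -- V19's floor `2L² ≤ B₃` and the (162)–(166♭) smallness letters of the closers, κ-generic
      (_ : 2 * (F.L : ℝ) ^ 2 ≤ B₃) (_ : 4 * C ≤ B₃) (_ : 16 * θ ≤ 1) (_ : (16 * Q + 1024 * κ ^ 2) * a₀ ≤ 1) (_ : 32 * κ * a₀ ≤ 1)
      -- the chart side's PER-LEVEL SIZE LETTERS — NO shear letters
      (β₁ β₂ s' t₁ : (ℕ → ℝ) → (ℕ → ℝ) → ℕ → ℝ)
      -- ★ HLETTERS-NORM (RANGED): signs only
      (_ : ∀ (ε δ : ℕ → ℝ) (j : ℕ), 0 < δ j → δ j ≤ a₁ → B₃ * δ j ≤ ε j → ε j ≤ a₀ → 0 ≤ β₁ ε δ j ∧ 0 ≤ β₂ ε δ j ∧ 0 ≤ s' ε δ j)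
      -- ★ HBUDGET-NORM (RANGED): no `t_D`, no `C_S·B_S`
      (_ : ∀ (K : ℕ) (ε δ : ℕ → ℝ) (j : ℕ), 0 < δ j → δ j ≤ a₁ → B₃ * δ j ≤ ε j → ε j ≤ a₀ → ∃ t₂ t₃ : ℝ,
        1 / 4 * ((sideP (F.P K) Mc ρ : ℕ) : ℝ) * max (4 * CH * BH * β₁ ε δ j) (θH * β₂ ε δ j) < t₂ ∧ 2 * CH * BH * s' ε δ j < t₃ ∧
        t₁ ε δ j + t₂ + t₃ < C * δ j + θ * ε j + Q * ε j ^ 2)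
      -- ★ THE NORMALISATION PREDICATE (abstract)
      (Nrm : ∀ (ν : Stage7Numerics) (M : ℕ) (g : ℕ → ℝ) (K k : ℕ), SeqOfRecord F ν M g K k → GaugeField (F.P K) 0 (SU N) → ℕ → Pt (F.P K).d →
        GaugeTransf (F.P K) 0 (SU N) → (PBond (F.P K) 0 → MatA N) → Prop)
      -- ★ HS3NORM
      (_ : ∀ (ν : Stage7Numerics) (M : ℕ) (g : ℕ → ℝ) (K k : ℕ) (s : SeqOfRecord F ν M g K k), Sect2.SeqSeparated ν.M₁ s → 0 < ν.M₁ →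
        Adm ν M g K k s → 1 ≤ k →
        ∀ (ε δ : ℕ → ℝ),
        (∀ n, n ≤ k → 0 < δ n ∧ δ n ≤ a₁) → (∀ n, n < k → δ n ≤ 2 * δ (n + 1)) → (∀ n, n < k → δ (n + 1) ≤ 2 * δ n) →
        (∀ n, n ≤ k → B₃ * δ n ≤ ε n ∧ ε n ≤ a₀) → (∀ n, n < k → ε n ≤ 2 * ε (n + 1)) → (∀ n, n < k → ε (n + 1) ≤ 2 * ε n) →
        ∀ W : MSField (F.P K) (SU N), Sect2.DataSmall7PTop (avOfRecord F N K) s.Ω (suppDomOfRecord F ν K s.Ω) k δ W →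
        ∀ U : GaugeField (F.P K) 0 (SU N),
        (∀ n, n ≤ k → PlaqSmallOn (Sect2.omegaPlaqsTop s.Ω (suppDomOfRecord F ν K s.Ω) n) (ε n * (F.P K).eta n ^ 2) U) →
        (∀ n, n ≤ k → Sect2.CoDivSmallOn (Sect2.omegaBondsTop s.Ω (suppDomOfRecord F ν K s.Ω) n) (ε n * (F.P K).eta n ^ 3) U) →
        AgreeOn (genSet s.Ω k) (avgFamily (avOfRecord F N K) U) W → IsCritOnFibre F N K (genSet s.Ω k) W U →
        ∀ (n : ℕ) (hk : K - n ≤ (F.P K).m + (F.P K).K), 1 ≤ K - n → K - n ≤ k → ∀ (idx : Pt (F.P K).d),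
        (∃ x ∈ box (F.P K).L (cornerP (F.P K) Mc ρ idx) (sideP (F.P K) Mc ρ) (K - n), ∃ y : Pt (F.P K).d, cover (F.P K) y ∈ s.Ω (K - n) ∧ Within ((3 : ℕ) : ℤ) x y) →
        (K - n = k ∨ ∀ z ∈ box (F.P K).L (cornerP (F.P K) Mc ρ idx) (sideP (F.P K) Mc ρ) (K - n), cover (F.P K) z ∉ s.Ω (K - n + 1)) →
        ∃ (u : GaugeTransf (F.P K) 0 (SU N)) (A : PBond (F.P K) 0 → MatA N),
        (∀ b ∈ (Sect2.regionOfSet (F.P K) (cover (F.P K) '' box (F.P K).L (cornerP (F.P K) Mc ρ idx) (sideP (F.P K) Mc ρ) (K - n))).bonds,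
          gaugeU (fun x => ιSU N (u x)) (fun b' => ιSU N (U b')) b = expI ((F.P K).eta (K - n)) (A b)) ∧
        (∀ b ∈ (Sect2.regionOfSet (F.P K) (cover (F.P K) '' box (F.P K).L (cornerP (F.P K) Mc ρ idx) (sideP (F.P K) Mc ρ) (K - n))).bonds,
          ‖A b‖ < κ * ε (K - n)) ∧
        (∀ q ∈ (Sect2.regionOfSet (F.P K) (cover (F.P K) '' box (F.P K).L (cornerP (F.P K) Mc ρ idx) (sideP (F.P K) Mc ρ) (K - n))).dpairs,
          ‖grad ((F.P K).eta (K - n)) q.2.1 (fun y => A ⟨y, q.2.2⟩) q.1‖ < κ * ε (K - n)) ∧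
        (∀ b ∈ Sect2.bondsDeep (cover (F.P K) '' box (F.P K).L (cornerP (F.P K) Mc ρ idx) (sideP (F.P K) Mc ρ) (K - n)),
          ‖Sect2.codiffCurlA ((F.P K).eta (K - n)) A b.src b.dir‖ < κ * ε (K - n)) ∧
        (∀ b ∈ Sect2.bondsDeep (cover (F.P K) '' box (F.P K).L (cornerP (F.P K) Mc ρ idx) (sideP (F.P K) Mc ρ) (K - n)),
          ‖∑ ν' : Fin (F.P K).d, (((F.P K).eta (K - n) : ℝ) : ℂ)⁻¹ •
              (grad ((F.P K).eta (K - n)) ν' (fun y => A ⟨y, b.dir⟩) (b.src.unshift ν') - grad ((F.P K).eta (K - n)) ν' (fun y => A ⟨y, b.dir⟩) b.src)‖ <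
            κ * ε (K - n)) ∧
        (∀ D' : Domains (F.P K), LinearMap.ker (QpE D') ≤
            LinearMap.ker (QpE (domainsMeet (cubeDomains (F.P K) (cornerP (F.P K) Mc ρ idx) (sideP (F.P K) Mc ρ) ρ (K - n) hk) (domainsOfSeq s.Ω (K - n) hk))) →
          ∀ φ : MatA N →L[ℂ] ℂ,
          RE D' ((F.P K).eta (K - n))⁻¹ (dsE ((F.P K).eta (K - n))⁻¹ (WithLp.toLp 2 fun b => (φ (A b)).re : BondSpace (F.P K))) = 0 ∧
          RE D' ((F.P K).eta (K - n))⁻¹ (dsE ((F.P K).eta (K - n))⁻¹ (WithLp.toLp 2 fun b => (φ (A b)).im : BondSpace (F.P K))) = 0) ∧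
        Nrm ν M g K k s U (K - n) idx u A)
      -- ★ HCHART-MEET-NORM
      (_ : ∀ (ν : Stage7Numerics) (M : ℕ) (g : ℕ → ℝ) (K k : ℕ) (s : SeqOfRecord F ν M g K k), Sect2.SeqSeparated ν.M₁ s → 0 < ν.M₁ →
        Adm ν M g K k s → 1 ≤ k →
        ∀ (ε δ : ℕ → ℝ),
        (∀ n, n ≤ k → 0 < δ n ∧ δ n ≤ a₁) → (∀ n, n < k → δ n ≤ 2 * δ (n + 1)) → (∀ n, n < k → δ (n + 1) ≤ 2 * δ n) →
        (∀ n, n ≤ k → B₃ * δ n ≤ ε n ∧ ε n ≤ a₀) → (∀ n, n < k → ε n ≤ 2 * ε (n + 1)) → (∀ n, n < k → ε (n + 1) ≤ 2 * ε n) →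
        ∀ W : MSField (F.P K) (SU N), Sect2.DataSmall7PTop (avOfRecord F N K) s.Ω (suppDomOfRecord F ν K s.Ω) k δ W →
        ∀ U : GaugeField (F.P K) 0 (SU N),
        (∀ n, n ≤ k → PlaqSmallOn (Sect2.omegaPlaqsTop s.Ω (suppDomOfRecord F ν K s.Ω) n) (ε n * (F.P K).eta n ^ 2) U) →
        (∀ n, n ≤ k → Sect2.CoDivSmallOn (Sect2.omegaBondsTop s.Ω (suppDomOfRecord F ν K s.Ω) n) (ε n * (F.P K).eta n ^ 3) U) →
        AgreeOn (genSet s.Ω k) (avgFamily (avOfRecord F N K) U) W → IsCritOnFibre F N K (genSet s.Ω k) W U →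
        ∀ (n : ℕ) (hk : K - n ≤ (F.P K).m + (F.P K).K), 1 ≤ K - n → K - n ≤ k → ∀ (idx : Pt (F.P K).d),
        (∃ x ∈ box (F.P K).L (cornerP (F.P K) Mc ρ idx) (sideP (F.P K) Mc ρ) (K - n), ∃ y : Pt (F.P K).d, cover (F.P K) y ∈ s.Ω (K - n) ∧ Within ((3 : ℕ) : ℤ) x y) →
        (K - n = k ∨ ∀ z ∈ box (F.P K).L (cornerP (F.P K) Mc ρ idx) (sideP (F.P K) Mc ρ) (K - n), cover (F.P K) z ∉ s.Ω (K - n + 1)) →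
        ∀ {HVd : Domains (F.P K)}
          (_ : HVd = domainsMeet (cubeDomains (F.P K) (cornerP (F.P K) Mc ρ idx) (sideP (F.P K) Mc ρ) ρ (K - n) hk) (domainsOfSeq s.Ω (K - n) hk))
          (lo hi : ℕ → Pt (F.P K).d),
        lo 0 = (fun i => ((F.P K).L : ℤ) * (sqLo (F.P K).L (cornerP (F.P K) Mc ρ idx) ρ (K - n) 1 i - 1)) →
        hi 0 = (fun i => ((F.P K).L : ℤ) * (sqHi (F.P K).L (cornerP (F.P K) Mc ρ idx) (sideP (F.P K) Mc ρ) ρ (K - n) 1 i + 1) + (((F.P K).L : ℤ) - 1)) →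
        (∀ j', 1 ≤ j' → lo j' = sqLo (F.P K).L (cornerP (F.P K) Mc ρ idx) ρ (K - n) j' - 1) →
        (∀ j', 1 ≤ j' → hi j' = sqHi (F.P K).L (cornerP (F.P K) Mc ρ idx) (sideP (F.P K) Mc ρ) ρ (K - n) j' + 1) →
        ∃ HV : (BondIdx HVd → MatA N) →ₗ[ℂ] (PBond (F.P K) 0 → MatA N),
          (∀ (Bf : BondIdx HVd → MatA N) (b : PBond (F.P K) 0), HV Bf b = ∑ c, ((flatH (F.P K) (K - n) HVd (Pi.single c 1) b : ℝ) : ℂ) • Bf c) ∧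
        ∀ (u : GaugeTransf (F.P K) 0 (SU N)) (A : PBond (F.P K) 0 → MatA N),
        (∀ b ∈ (Sect2.regionOfSet (F.P K) (cover (F.P K) '' box (F.P K).L (cornerP (F.P K) Mc ρ idx) (sideP (F.P K) Mc ρ) (K - n))).bonds,
          gaugeU (fun x => ιSU N (u x)) (fun b' => ιSU N (U b')) b = expI ((F.P K).eta (K - n)) (A b)) →
        (∀ b ∈ (Sect2.regionOfSet (F.P K) (cover (F.P K) '' box (F.P K).L (cornerP (F.P K) Mc ρ idx) (sideP (F.P K) Mc ρ) (K - n))).bonds,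
          ‖A b‖ < κ * ε (K - n)) →
        (∀ q ∈ (Sect2.regionOfSet (F.P K) (cover (F.P K) '' box (F.P K).L (cornerP (F.P K) Mc ρ idx) (sideP (F.P K) Mc ρ) (K - n))).dpairs,
          ‖grad ((F.P K).eta (K - n)) q.2.1 (fun y => A ⟨y, q.2.2⟩) q.1‖ < κ * ε (K - n)) →
        (∀ b ∈ Sect2.bondsDeep (cover (F.P K) '' box (F.P K).L (cornerP (F.P K) Mc ρ idx) (sideP (F.P K) Mc ρ) (K - n)),
          ‖Sect2.codiffCurlA ((F.P K).eta (K - n)) A b.src b.dir‖ < κ * ε (K - n)) →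
        (∀ b ∈ Sect2.bondsDeep (cover (F.P K) '' box (F.P K).L (cornerP (F.P K) Mc ρ idx) (sideP (F.P K) Mc ρ) (K - n)),
          ‖∑ ν' : Fin (F.P K).d, (((F.P K).eta (K - n) : ℝ) : ℂ)⁻¹ •
              (grad ((F.P K).eta (K - n)) ν' (fun y => A ⟨y, b.dir⟩) (b.src.unshift ν') - grad ((F.P K).eta (K - n)) ν' (fun y => A ⟨y, b.dir⟩) b.src)‖ <
            κ * ε (K - n)) →
        (∀ D' : Domains (F.P K), LinearMap.ker (QpE D') ≤ LinearMap.ker (QpE HVd) → ∀ φ : MatA N →L[ℂ] ℂ,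
          RE D' ((F.P K).eta (K - n))⁻¹ (dsE ((F.P K).eta (K - n))⁻¹ (WithLp.toLp 2 fun b => (φ (A b)).re : BondSpace (F.P K))) = 0 ∧
          RE D' ((F.P K).eta (K - n))⁻¹ (dsE ((F.P K).eta (K - n))⁻¹ (WithLp.toLp 2 fun b => (φ (A b)).im : BondSpace (F.P K))) = 0) →
        Nrm ν M g K k s U (K - n) idx u A →
        ∃ (xc : Pt (F.P K).d) (B B' : BondIdx HVd → MatA N) (A₁ : PBond (F.P K) 0 → MatA N),
          xc ∈ box (F.P K).L (cornerP (F.P K) Mc ρ idx) (sideP (F.P K) Mc ρ) (K - n) ∧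
          (∀ c : BondIdx HVd, ((c.1.1 : ℕ) = K - n ∨ blockOf c.1.2.src ∈ (cubeDomains (F.P K) (cornerP (F.P K) Mc ρ idx) (sideP (F.P K) Mc ρ) ρ (K - n) hk).Om ((c.1.1 : ℕ) + 1)) →
            ‖B c‖ ≤ β₁ ε δ (K - n) * (distSite (Mk (F.P K) (c.1.1 : ℕ)) c.1.2.src (iterBlockOf (c.1.1 : ℕ) (cover (F.P K) xc)) + 1)) ∧
          (∀ c : BondIdx HVd, ¬ ((c.1.1 : ℕ) = K - n ∨ blockOf c.1.2.src ∈ (cubeDomains (F.P K) (cornerP (F.P K) Mc ρ idx) (sideP (F.P K) Mc ρ) ρ (K - n) hk).Om ((c.1.1 : ℕ) + 1)) →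
            ‖B c‖ ≤ β₂ ε δ (K - n) * ((ρ : ℝ) + ((sideP (F.P K) Mc ρ : ℕ) : ℝ))) ∧
          (∀ c, ‖B' c‖ ≤ s' ε δ (K - n)) ∧
          Letters10On (cover (F.P K) '' box (F.P K).L (cornerP (F.P K) Mc ρ idx) (sideP (F.P K) Mc ρ) (K - n)) ((F.P K).eta (K - n)) (t₁ ε δ (K - n)) A₁ ∧
          (∀ b, A b = A₁ b + HV B b - HV B' b)),
      Prop8RegSepTopStepG F N (fun ν K Ω => suppDomOfRecord F ν K Ω) Adm B₃ a₀ a₁ := by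
  obtain ⟨Mh₀, R₀, CH, δH, BH, hCH, hδH, hBH, hmain⟩ := datumGaugeSplitTopStepCoreG_of_normalisedGauge_of_chartMeet F N
  refine ⟨Mh₀, R₀, CH, δH, BH, hCH, hδH, hBH, ?_⟩
  intro ρ Mc Mh R a' hMc hMcρ hMha hMh hR hdvd hRρ hLρ c c₀ hc hc₀ hmc₀ hac₀ Adm hAdm₁ hAdm₂ B₃ C θ Q κ a₀ a₁ θH hB₃ hC0 hθ0 hQ0 hκ0 h163
    hB₃L hC hθ ha hκa β₁ β₂ s' t₁ hletters hbudget Nrm hS3 hchart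
  exact prop8RegSepTopStepG_of_datumGaugeSplitCoreG hMc hLρ
    (hmain hMc hMcρ hMha hMh hR hdvd hRρ hLρ hc hc₀ hmc₀ hac₀ Adm hAdm₁ hAdm₂ hB₃ hC0 hθ0 hQ0 hκ0 h163 β₁ β₂ s' t₁ hletters hbudget Nrm hS3 hchart)
    hB₃L hC hθ hQ0 hκ0 ha hκa

end Summit.QuantumFields.YangMills.BalabanUVNodes.N07SplitClauseHeadKnitMeetNormalisedStep

end
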